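import Summits.BirchSwinnertonDyer.BirchSwinnertonDyer.Theorems.ManinLocalTwoThreeOddCongruenceNumber
import Literature.NumberTheory.EllipticCurves.ManinConstantModularDegree
import Literature.NumberTheory.EllipticCurves.CuspFormLFunctionLevelConductorProofs
import HarnessLib

/-!
# E-imc-90 for the newform of an elliptic curve: certificate ⟹ `r_f` odd ⟹ (Ribet) `deg φ` odd ⟹ (ČNS) Manin constant odd

Summit `BirchSwinnertonDyer`, route `ManinLocalTwoThree` (cell bsd-f2-manin), deciding crux C2 `ManinOddAtFour`
(stmt-BirchSwinnertonDyer-22967); IMC lens (imc g15, MEMO-imc §21: the plumbing E-90 → E-84 → E-82, ref1 §R58 F-4).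
The three kernel edges that make the THEOREM `OddCongruenceNumberOfIsolationCertificate_holds`
(`ManinLocalTwoThreeOddCongruenceNumber`) consumable by the C2 line on a certified level:
* `odd_congruenceNumber_of_twoAdicIsolationCertificate` — for a datum `D` (so `D.f` is a normalised newform with the
  integer Hecke eigenvalues of `W`), a 2-adic isolation certificate at an odd prime `ℓ ∤ N` with even eigenvalue `a`
  gives `r_{D.f}` odd (unconditional);
* `odd_modularDegree_of_twoAdicIsolationCertificate` — with Ribet's theorem `deg φ ∣ r_f` (the tree's NAMED FACT
  `modularDegree_dvd_congruenceNumber`, taken as a hypothesis: CONDITIONAL) and `D` of minimal degree, `deg φ` is odd;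
* `not_two_dvd_maninConstant_of_twoAdicIsolationCertificate` — with moreover ČNS Thm 1.2 and modularity (cite-only tree
  facts, hypotheses) and the level outside the printed exceptional clause at `2`, the Manin constant of `D` is odd
  (the argument of the tree's odd-degree tooth `not_two_dvd_maninConstant_of_cns_of_odd_deg`, inlined to keep this file
  off the route cone).
Nothing about BSD or Manin's conjecture in general is asserted; the last two theorems are conditional on the named facts
they take as hypotheses.
-/

set_option linter.dupNamespace false

noncomputable section

open scoped MatrixGroups
open CongruenceSubgroup
open Literature.NumberTheory.EllipticCurves Literature.NumberTheory.EllipticCurves.ModularForms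
open Summit.BirchSwinnertonDyer.Rank1Residual.ManinAdditive.TwoEisenstein

namespace Summit.BirchSwinnertonDyer.BirchSwinnertonDyer.Theorems.ManinLocalTwoThree

variable {N : ℕ} [NeZero N] {W : WeierstrassCurve ℚ}

/-- **`r_f` odd from a 2-adic isolation certificate, for the newform of an elliptic curve.**  For a parametrisation
datum `D` at level `N`, an odd prime `ℓ ∤ N` with `T_ℓ D.f = a • D.f`, `a` even, and a 2-adic isolation certificate
at `(N, ℓ, a)`, the congruence number of `D.f` is odd (E-imc-90 applied with `a₁(D.f) = 1`, `D.f ∈ S(ℤ)`). [folklore] -/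
theorem odd_congruenceNumber_of_twoAdicIsolationCertificate (D : ModularParametrizationData W N)
    {ℓ : ℕ} [NeZero ℓ] (hℓ : ℓ.Prime) (hodd : Odd ℓ) (hℓN : ¬ ℓ ∣ N) {a : ℤ}
    (hTa : heckeT (Gamma0 N) 2 ℓ D.f = (a : ℂ) • D.f) (ha : (2 : ℤ) ∣ a)
    (hcert : TwoAdicIsolationCertificate N ℓ a) :
    Odd (congruenceNumber D.f) := by
  obtain ⟨-, -, hf1⟩ := D.isNewformOf.1
  exact OddCongruenceNumberOfIsolationCertificate_holds N ℓ hℓ D.f a hodd hℓN D.f_mem_integralCuspForms0 hf1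
    hTa ha hcert

/-- **Odd modular degree from a 2-adic isolation certificate (conditional on Ribet's `deg φ ∣ r_f`).**  Granted the
named fact `modularDegree_dvd_congruenceNumber` (Agashe–Ribet–Stein 2012, Thm. 2.1, taken as a hypothesis), for a datum
`D` of minimal degree among the data with the same newform, a certificate as above makes `deg φ` odd.
[cite: AgasheRibetStein2012, Thm. 2.1] -/
theorem odd_modularDegree_of_twoAdicIsolationCertificate [W.IsElliptic] (hR : modularDegree_dvd_congruenceNumber)
    (D : ModularParametrizationData W N)
    (hmin : ∀ (W' : WeierstrassCurve ℚ) [W'.IsElliptic] (D' : ModularParametrizationData W' N),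
      D'.f = D.f → D.modularDegree ≤ D'.modularDegree)
    {ℓ : ℕ} [NeZero ℓ] (hℓ : ℓ.Prime) (hodd : Odd ℓ) (hℓN : ¬ ℓ ∣ N) {a : ℤ}
    (hTa : heckeT (Gamma0 N) 2 ℓ D.f = (a : ℂ) • D.f) (ha : (2 : ℤ) ∣ a)
    (hcert : TwoAdicIsolationCertificate N ℓ a) :
    Odd D.modularDegree :=
  (odd_congruenceNumber_of_twoAdicIsolationCertificate D hℓ hodd hℓN hTa ha hcert).of_dvd_nat (hR W N D hmin)

/-- **Odd Manin constant from a 2-adic isolation certificate (conditional on Ribet, ČNS Thm 1.2 and modularity).**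
For a globally minimal `W` and a minimal-degree datum `D` at a level `N` outside the printed exceptional clause at `2`
(`8 ∤ N`, or some prime `≡ 3 (mod 4)` divides `N`), a certificate at an odd prime `ℓ ∤ N` with even `a = a_ℓ` gives
`2 ∤ c(D)`: certificate ⟹ `r_f` odd ⟹ `deg φ` odd (Ribet) ⟹ Manin constant odd (the tree's odd-degree tooth
`not_two_dvd_maninConstant_of_cns_of_odd_deg`, ČNS 2023 Thm. 1.2, inlined). [cite: CesnaviciusNeururerSaha2023, Thm. 1.2]
[cite: AgasheRibetStein2012, Thm. 2.1] -/
theorem not_two_dvd_maninConstant_of_twoAdicIsolationCertificate (hR : modularDegree_dvd_congruenceNumber)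
    (hcns : cesnaviciusNeururerSaha_thm_1_2) (hnf : exists_isNewformOf)
    (W : WeierstrassCurve ℚ) [W.IsElliptic] [W.IsGloballyMinimal] (D : ModularParametrizationData W N)
    (hmin : ∀ (W' : WeierstrassCurve ℚ) [W'.IsElliptic] (D' : ModularParametrizationData W' N),
      D'.f = D.f → D.modularDegree ≤ D'.modularDegree)
    (hN : ¬ 2 ^ 3 ∣ N ∨ ∃ q : ℕ, q.Prime ∧ q ∣ N ∧ q % 4 = 3)
    {ℓ : ℕ} [NeZero ℓ] (hℓ : ℓ.Prime) (hodd : Odd ℓ) (hℓN : ¬ ℓ ∣ N) {a : ℤ}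
    (hTa : heckeT (Gamma0 N) 2 ℓ D.f = (a : ℂ) • D.f) (ha : (2 : ℤ) ∣ a)
    (hcert : TwoAdicIsolationCertificate N ℓ a) :
    ¬ (2 : ℤ) ∣ D.maninConstant := by
  have hdeg := odd_modularDegree_of_twoAdicIsolationCertificate hR D hmin hℓ hodd hℓN hTa ha hcert
  have hlev : N = W.conductorNorm ℤ :=
    IsNewformOf.level_eq_conductorNorm_of_exists_isNewformOf hnf D.isNewformOf
  subst hlev
  exact not_dvd_maninConstant_of_padicVal_le_of_not_dvd D Nat.prime_two
    (padicValInt_two_maninConstant_le_modularDegree hcns W D hN)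
    (fun h2 ↦ (Nat.not_even_iff_odd.mpr hdeg) (even_iff_two_dvd.mpr h2))

end Summit.BirchSwinnertonDyer.BirchSwinnertonDyer.Theorems.ManinLocalTwoThree

end
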